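import Literature.AnabelianGeometry.SemiGraphs.ProSigmaCompletionProfiniteExtend
import Literature.AnabelianGeometry.SemiGraphs.ProSigmaCompletionRestrict
import Literature.AnabelianGeometry.AbsoluteAnabelian.AbsTopII.InertiaGroups
import Mathlib.Data.ZMod.QuotientGroup
import HarnessLib

/-!
# A pro-`Σ` completion of `ℤ` is free pro-`Σ`-cyclic (`≅ Ẑ^Σ`)

[AbsTopII] Prop 1.3 (i)/(ii)/(iii) p. 11 (bib `MochizukiAbsTopII2013`; kurims manuscript
`paper:url-585b8d0ad0d9`) phrase «as abstract profinite groups, `≅ Ẑ^Σ`», which the cell types INTRINSICALLY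
as abc-iut-L4-t6's `AbsTopII.IsFreeProSigmaCyclic Σ` (a dense cyclic subgroup; the indices of the open
subgroups are exactly the `Σ`-integers).  [SemiAnbd] Ex. 2.10 p. 31 (bib `MochizukiSemiAnbd2006`): the groups
of the construction are maximal pro-`Σ` quotients (= pro-`Σ` completions, the tree's `IsProSigmaCompletion`).

PROOF-ONLY file (no definitions; abc-iut-f-066 gen 5, row «P13-TWO-VERTEX-NODAL-MODEL», generic part):

* `isFreeProSigmaCyclic_of_isProSigmaCompletion_int` — **if `κ : ℤ → A` is a pro-`Σ` completion of the
  infinite cyclic group (`A` profinite), then `A` is free pro-`Σ`-cyclic**: `A` is abelian (a dense abelian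
  subgroup), `⟨κ 1⟩ = κ(ℤ)` is dense, open subgroups have `Σ`-integer index (they contain an open normal
  subgroup), and for a `Σ`-integer `n` the pull-back property of `nℤ` yields an open `U ≤ A` with
  `κ⁻¹ U = nℤ`, whose index is the order `n` of the dense generator modulo `U`;
* `isFreeProSigmaCyclic_of_isProSigmaCompletion_of_zpowers` — the same for a pro-`Σ` completion of ANY
  infinite cyclic group `zpowers g` (`g` of infinite order), through `ℤ ≃* zpowers g`.

Used for the log inertia `I ≅ Ẑ^Σ`, the nodal `Π_e ≅ Ẑ^Σ` and the vertex inertia of the two-vertex nodal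
DPSC model.  Classical profinite group theory; no side taken on [IUTchIII] Cor 3.12.
-/

namespace Literature.AnabelianGeometry.SemiGraphs.SemiGraphOfAnabelioids.IsProSigmaCompletion

open Literature.AnabelianGeometry.Anabelioids (IsSigmaInteger)
open Literature.AnabelianGeometry.AbsoluteAnabelian (AbsTopII.IsFreeProSigmaCyclic)
open Topology

variable {Sigma : Set ℕ} {A : Type*} [Group A] [TopologicalSpace A] [IsTopologicalGroup A] [T2Space A]

/-- A topological group with a dense abelian image is abelian. [cite: MochizukiSemiAnbd2006, Ex. 2.10 p.31] -/
theorem mul_comm_of_denseRange {Γ : Type*} [CommGroup Γ] (κ : Γ →* A) (hd : DenseRange κ) (x y : A) :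
    x * y = y * x := by
  refine hd.induction_on₂ (p := fun x y : A => x * y = y * x) ?_ (fun a b => ?_) x y
  · exact isClosed_eq (continuous_fst.mul continuous_snd) (continuous_snd.mul continuous_fst)
  · rw [← map_mul, ← map_mul, mul_comm]

/-- **A pro-`Σ` completion of `ℤ` is free pro-`Σ`-cyclic** («as abstract profinite groups, `≅ Ẑ^Σ`»):
for `κ : ℤ → A` a pro-`Σ` completion (`A` a Hausdorff topological group), `A` has the dense cyclic subgroup `⟨κ 1⟩` and its
open subgroups have exactly the `Σ`-integers as indices. [cite: MochizukiAbsTopII2013, Prop 1.3 (i) p.11]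
[cite: MochizukiSemiAnbd2006, Ex. 2.10 p.31] -/
theorem isFreeProSigmaCyclic_of_isProSigmaCompletion_int {κ : Multiplicative ℤ →* A}
    (hκ : IsProSigmaCompletion Sigma κ) : AbsTopII.IsFreeProSigmaCyclic Sigma A := by
  classical
  set a : A := κ (Multiplicative.ofAdd 1) with ha_def
  have hpow : ∀ m : ℤ, κ (Multiplicative.ofAdd m) = a ^ m := fun m => by
    rw [ha_def, ← map_zpow, ← ofAdd_zsmul, smul_eq_mul, mul_one]
  -- `⟨a⟩ = κ(ℤ)` is dense
  have hrange : Set.range κ ⊆ (Subgroup.zpowers a : Set A) := by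
    rintro _ ⟨m, rfl⟩
    refine ⟨Multiplicative.toAdd m, ?_⟩
    change a ^ (Multiplicative.toAdd m) = κ m
    rw [← hpow, ofAdd_toAdd]
  have hdense : Dense (Subgroup.zpowers a : Set A) := hκ.dense.mono hrange
  -- `A` is abelian
  have hcomm : ∀ x y : A, x * y = y * x := mul_comm_of_denseRange κ hκ.dense
  refine ⟨⟨a, hdense⟩, fun n => ⟨?_, fun hn => ?_⟩⟩
  · -- an open subgroup contains an open normal subgroup, of `Σ`-integer index
    rintro ⟨H, hHo, rfl⟩
    haveI : H.Normal := ⟨fun h hh g => by rwa [hcomm g h, mul_inv_cancel_right]⟩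
    exact hκ.index_open H inferInstance hHo
  -- the pull-back property for `nℤ`
  let N : Subgroup (Multiplicative ℤ) := Subgroup.zpowers (Multiplicative.ofAdd (n : ℤ))
  haveI : N.Normal := inferInstance
  have hmemN : ∀ m : ℤ, Multiplicative.ofAdd m ∈ N ↔ (n : ℤ) ∣ m := by
    intro m
    constructor
    · rintro ⟨k, hk⟩
      change Multiplicative.ofAdd (n : ℤ) ^ k = Multiplicative.ofAdd m at hk
      refine ⟨k, ?_⟩
      have hk' : Multiplicative.ofAdd ((n : ℤ) * k) = Multiplicative.ofAdd m := by
        rw [← hk, ← ofAdd_zsmul, smul_eq_mul, mul_comm]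
      exact (Multiplicative.ofAdd.injective hk').symm
    · rintro ⟨k, rfl⟩
      refine ⟨k, ?_⟩
      change Multiplicative.ofAdd (n : ℤ) ^ k = Multiplicative.ofAdd ((n : ℤ) * k)
      rw [← ofAdd_zsmul, smul_eq_mul, mul_comm]
  have hNidx : N.index = n := by
    have hsurj : Function.Surjective
        ((Int.castAddHom (ZMod n)).toMultiplicative : Multiplicative ℤ →* Multiplicative (ZMod n)) :=
      fun z => ⟨Multiplicative.ofAdd ((Multiplicative.toAdd z).cast : ℤ), by
        change Multiplicative.ofAdd (((Multiplicative.toAdd z).cast : ℤ) : ZMod n) = z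
        rw [ZMod.intCast_zmod_cast, ofAdd_toAdd]⟩
    have hker : ((Int.castAddHom (ZMod n)).toMultiplicative :
        Multiplicative ℤ →* Multiplicative (ZMod n)).ker = N := by
      ext m
      rw [MonoidHom.mem_ker, ← ofAdd_toAdd m, hmemN]
      change Multiplicative.ofAdd ((Multiplicative.toAdd m : ℤ) : ZMod n) = Multiplicative.ofAdd 0 ↔ _
      rw [Multiplicative.ofAdd.injective.eq_iff, ZMod.intCast_zmod_eq_zero_iff_dvd]
    rw [← hker, Subgroup.index_ker, MonoidHom.range_eq_top.mpr hsurj, Subgroup.card_top]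
    change Nat.card (ZMod n) = n
    exact Nat.card_zmod n
  have hNσ : IsSigmaInteger Sigma N.index := by rw [hNidx]; exact hn
  obtain ⟨U, hUo, hUN⟩ := hκ.comap_surj N inferInstance hNσ
  haveI : U.Normal := ⟨fun h hh g => by rwa [hcomm g h, mul_inv_cancel_right]⟩
  have hmemU : ∀ m : ℕ, a ^ m ∈ U ↔ n ∣ m := fun m => by
    rw [← zpow_natCast, ← hpow, ← Subgroup.mem_comap, hUN, hmemN, Int.natCast_dvd_natCast]
  refine ⟨U, hUo, ?_⟩
  -- the image of `a` in `A ⧸ U` has order `n` …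
  have horder : orderOf (QuotientGroup.mk (s := U) a) = n := by
    refine (orderOf_eq_iff hn.1).mpr ⟨?_, fun m hm hm0 hm1 => ?_⟩
    · rw [← QuotientGroup.mk_pow, QuotientGroup.eq_one_iff]
      exact (hmemU n).mpr dvd_rfl
    · rw [← QuotientGroup.mk_pow, QuotientGroup.eq_one_iff, hmemU] at hm1
      exact absurd (Nat.le_of_dvd hm0 hm1) (not_le.mpr hm)
  -- … and generates `A ⧸ U`: every coset is open, hence contains a power of the dense generator
  have hUo' : IsOpen ((U : Subgroup A) : Set A) := hUo
  have hgen : Subgroup.zpowers (QuotientGroup.mk (s := U) a) = ⊤ := by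
    rw [eq_top_iff]
    rintro q -
    obtain ⟨b, rfl⟩ := QuotientGroup.mk_surjective q
    obtain ⟨y, hy, hyb⟩ := hdense.exists_mem_open (hUo'.leftCoset b) ⟨b * 1, mem_leftCoset b U.one_mem⟩
    have hq : (QuotientGroup.mk b : A ⧸ U) = QuotientGroup.mk y :=
      QuotientGroup.eq.mpr ((mem_leftCoset_iff b).mp hyb)
    obtain ⟨k, rfl⟩ := Subgroup.mem_zpowers_iff.mp hy
    rw [hq, QuotientGroup.mk_zpow]
    exact ⟨k, rfl⟩
  calc U.index = Nat.card (A ⧸ U) := U.index_eq_card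
    _ = Nat.card (⊤ : Subgroup (A ⧸ U)) := Subgroup.card_top.symm
    _ = Nat.card (Subgroup.zpowers (QuotientGroup.mk (s := U) a)) := by rw [hgen]
    _ = orderOf (QuotientGroup.mk (s := U) a) := Nat.card_zpowers _
    _ = n := horder

/-- The same through an isomorphism `ℤ ≅ Γ'` of the completed group (any infinite cyclic group).
[cite: MochizukiAbsTopII2013, Prop 1.3 (i) p.11] [cite: MochizukiSemiAnbd2006, Ex. 2.10 p.31] -/
theorem isFreeProSigmaCyclic_of_isProSigmaCompletion_of_mulEquiv {Γ' : Type*} [Group Γ']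
    (e : Multiplicative ℤ ≃* Γ') {κ : Γ' →* A} (hκ : IsProSigmaCompletion Sigma κ) :
    AbsTopII.IsFreeProSigmaCyclic Sigma A :=
  isFreeProSigmaCyclic_of_isProSigmaCompletion_int
    (of_comp_mulEquiv (ι := κ) (ι' := κ.comp e.toMonoidHom) e (fun _ => rfl) hκ)

/-- `ℤ ≅ ⟨g⟩` for an element `g` of infinite order (`n ↦ g ^ n`). [cite: MochizukiSemiAnbd2006, Ex. 2.10 p.31] -/
theorem exists_mulEquiv_zpowers_of_not_isOfFinOrder {Γ : Type*} [Group Γ] {g : Γ} (hg : ¬ IsOfFinOrder g) :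
    ∃ e : Multiplicative ℤ ≃* Subgroup.zpowers g, ∀ n : ℤ,
      ((e (Multiplicative.ofAdd n) : Subgroup.zpowers g) : Γ) = g ^ n := by
  let f : Multiplicative ℤ →* Subgroup.zpowers g :=
    { toFun := fun n => ⟨g ^ (Multiplicative.toAdd n), ⟨Multiplicative.toAdd n, rfl⟩⟩
      map_one' := Subtype.ext (by simp)
      map_mul' := fun m n => Subtype.ext (by simp [zpow_add]) }
  have hf : Function.Bijective f := by
    constructor
    · intro m n h
      have h' : g ^ (Multiplicative.toAdd m) = g ^ (Multiplicative.toAdd n) := congrArg Subtype.val h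
      exact Multiplicative.toAdd.injective ((injective_zpow_iff_not_isOfFinOrder.mpr hg) h')
    · rintro ⟨_, k, rfl⟩
      exact ⟨Multiplicative.ofAdd k, rfl⟩
  exact ⟨MulEquiv.ofBijective f hf, fun n => rfl⟩

/-- **A pro-`Σ` completion of an infinite cyclic group `⟨g⟩` is free pro-`Σ`-cyclic** (through
`ℤ ≃* ⟨g⟩` for `g` of infinite order). [cite: MochizukiAbsTopII2013, Prop 1.3 (i) p.11]
[cite: MochizukiSemiAnbd2006, Ex. 2.10 p.31] -/
theorem isFreeProSigmaCyclic_of_isProSigmaCompletion_zpowers {Γ : Type*} [Group Γ] {g : Γ}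
    (hg : ¬ IsOfFinOrder g) {κ : Subgroup.zpowers g →* A} (hκ : IsProSigmaCompletion Sigma κ) :
    AbsTopII.IsFreeProSigmaCyclic Sigma A := by
  obtain ⟨e, -⟩ := exists_mulEquiv_zpowers_of_not_isOfFinOrder hg
  exact isFreeProSigmaCyclic_of_isProSigmaCompletion_of_mulEquiv e hκ

end Literature.AnabelianGeometry.SemiGraphs.SemiGraphOfAnabelioids.IsProSigmaCompletion
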